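import Summits.CriticalPhenomena.PercolationContinuityZ3.Theorems.PercNearOneGluingNoHeavyLowerTailStarSetForestComonotone
import Summits.CriticalPhenomena.PercolationContinuityZ3.Theorems.PercNearOneGluingNoHeavyLowerTailStarSetTriangleCertificateCore2
import HarnessLib

/-!
# `NoHeavyLowerTail` (stmt-CriticalPhenomena-4575) — pointwise facts for the PAIR-ROW certificate (level `j ≤ 2`)

Support file (prover `prim-gen-swap` gen 9; `--supports stmt-CriticalPhenomena-4575`).  No definitions, no named facts, no sorries.

The observer-extension inequality for a multigraph of two-port pendant stars (classes `I : Fin M` with ports `P I ≠ P' I`) was so far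
certified by CHAMPION rows only (forests, class forests, the triangle).  Seat memo MWF-CERT.md adds the RELAY-PAIR rows
`CS({P K, P' K}; c)` (`StarSet.linkRow_le`): the pair row of a class pays exactly its lonely term.  This file supplies the two pointwise
facts behind that bookkeeping, for a fixed configuration `ω` (in the application the configuration off the stars) and links
`L_S = {P I P' I : I ∈ S}`:

* `StarSet.pair_lonely_links` — if the pair `R_K = {P K, P' K}` is lonely in `ω` (separated from `c`, at most `j` relays) and every class of
  `S` other than `K` shares no port with `K`, then `R_K` is lonely in `ω ∪ L_S` as well;
* `StarSet.classes_c_trichotomy` — for `c ∈ A` off the ports: either `c` sees more than `j` relays under every link pattern, or at most `j`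
  under every pattern while being separated from all ports, or `c` is glued to exactly one port `r` (then `c` stays light exactly under the
  patterns avoiding `r`, which do not change its cluster, and no other relay is joined to `c`).
-/

noncomputable section

namespace Summit.CriticalPhenomena.PercolationContinuityZ3.Theorems

open MeasureTheory Set Literature.Probability.LatticeModels Literature.Probability.Percolation
open scoped Classical BigOperators

variable {n M : ℕ}

namespace StarSet

/-- **A lonely class-pair stays lonely under far links (and under its own link).**  See the file header. [folklore] -/
theorem pair_lonely_links (ω : BondConfig (Fin n)) (A : Finset (Fin n)) (P P' : Fin M → Fin n) (K : Fin M) (S : Finset (Fin M))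
    (c : Fin n) (j : ℕ) (hj : j ≤ 2) (hPA : ∀ I, P I ∈ A) (hP'A : ∀ I, P' I ∈ A) (hPP' : ∀ I, P I ≠ P' I)
    (hfar : ∀ I ∈ S, I ≠ K → ¬ (P I = P K ∨ P I = P' K ∨ P' I = P K ∨ P' I = P' K))
    (hsep : ∀ u ∈ ({K} : Finset (Fin M)).image P ∪ ({K} : Finset (Fin M)).image P', ¬ (openGraph ω).Reachable c u)
    (hl : (A.filter fun z => ∃ u ∈ ({K} : Finset (Fin M)).image P ∪ ({K} : Finset (Fin M)).image P',
      (openGraph ω).Reachable u z).card ≤ j) :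
    (∀ u ∈ ({K} : Finset (Fin M)).image P ∪ ({K} : Finset (Fin M)).image P',
        ¬ (openGraph (ω ∪ ↑(S.image fun I => (s(P I, P' I) : Sym2 (Fin n))))).Reachable c u) ∧
      1 ≤ (A.filter fun z => ∃ u ∈ ({K} : Finset (Fin M)).image P ∪ ({K} : Finset (Fin M)).image P',
        (openGraph (ω ∪ ↑(S.image fun I => (s(P I, P' I) : Sym2 (Fin n))))).Reachable u z).card ∧
      (A.filter fun z => ∃ u ∈ ({K} : Finset (Fin M)).image P ∪ ({K} : Finset (Fin M)).image P',
        (openGraph (ω ∪ ↑(S.image fun I => (s(P I, P' I) : Sym2 (Fin n))))).Reachable u z).card ≤ j := by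
  obtain ⟨hrel, hj2⟩ := lonely_pair_relays ω A P P' K j hj hPA hP'A hPP' ((card_filter_congr fun _ _ => Iff.rfl).trans_le hl)
  set Λ : Set (Sym2 (Fin n)) := ↑(S.image fun I => (s(P I, P' I) : Sym2 (Fin n))) with hΛ
  set X : Set (Fin n) := {v | (openGraph ω).Reachable (P K) v ∨ (openGraph ω).Reachable (P' K) v} with hX
  have hmemR : ∀ u, u ∈ ({K} : Finset (Fin M)).image P ∪ ({K} : Finset (Fin M)).image P' ↔ u = P K ∨ u = P' K := by
    intro u; simp only [Finset.image_singleton, Finset.mem_union, Finset.mem_singleton]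
  -- `X` is closed under the adjacency of `ω ∪ Λ`
  have hclosed : ∀ u v, u ∈ X → (openGraph (ω ∪ Λ)).Adj u v → v ∈ X := by
    intro u v hu huv
    rw [openGraph_adj, mem_union] at huv
    obtain ⟨huv, hne⟩ := huv
    rcases huv with hω | hL
    · have hadj : (openGraph ω).Adj u v := by rw [openGraph_adj]; exact ⟨hω, hne⟩
      rcases hu with hu | hu
      · exact Or.inl (hu.trans hadj.reachable)
      · exact Or.inr (hu.trans hadj.reachable)
    · rw [hΛ, Finset.mem_coe, Finset.mem_image] at hL
      obtain ⟨I, hIS, hI⟩ := hL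
      have huport : u = P I ∨ u = P' I := by
        rcases Sym2.eq_iff.1 hI with ⟨h1, _⟩ | ⟨_, h1⟩
        · exact Or.inl h1.symm
        · exact Or.inr h1.symm
      have hvport : v = P I ∨ v = P' I := by
        rcases Sym2.eq_iff.1 hI with ⟨_, h2⟩ | ⟨h2, _⟩
        · exact Or.inr h2.symm
        · exact Or.inl h2.symm
      have huA : u ∈ A := by rcases huport with rfl | rfl; exacts [hPA I, hP'A I]
      have huK : u = P K ∨ u = P' K := hrel u huA hu
      by_cases hIK : I = K
      · subst hIK
        rcases hvport with rfl | rfl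
        · exact Or.inl (SimpleGraph.Reachable.refl _)
        · exact Or.inr (SimpleGraph.Reachable.refl _)
      · exfalso
        refine hfar I hIS hIK ?_
        rcases huport with rfl | rfl <;> rcases huK with h | h
        · exact Or.inl h
        · exact Or.inr (Or.inl h)
        · exact Or.inr (Or.inr (Or.inl h))
        · exact Or.inr (Or.inr (Or.inr h))
  have hstay : ∀ x z, x ∈ X → (openGraph (ω ∪ Λ)).Reachable x z → z ∈ X :=
    fun x z hx hxz => reachable_of_adjClosed (openGraph (ω ∪ Λ)) X hx hclosed hxz
  have hPKX : P K ∈ X := Or.inl (SimpleGraph.Reachable.refl _)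
  have hP'KX : P' K ∈ X := Or.inr (SimpleGraph.Reachable.refl _)
  refine ⟨?_, ?_, ?_⟩
  · intro u hu hcu
    have huX : u ∈ X := by
      rcases (hmemR u).1 hu with rfl | rfl
      · exact hPKX
      · exact hP'KX
    have hcX : c ∈ X := hstay u c huX hcu.symm
    rcases hcX with h | h
    · exact hsep (P K) ((hmemR _).2 (Or.inl rfl)) h.symm
    · exact hsep (P' K) ((hmemR _).2 (Or.inr rfl)) h.symm
  · exact Finset.card_pos.2 ⟨P K, Finset.mem_filter.2 ⟨hPA K, P K, (hmemR _).2 (Or.inl rfl), SimpleGraph.Reachable.refl _⟩⟩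
  · rw [hj2]
    have hsub : (A.filter fun z => ∃ u ∈ ({K} : Finset (Fin M)).image P ∪ ({K} : Finset (Fin M)).image P',
        (openGraph (ω ∪ Λ)).Reachable u z) ⊆ ({P K, P' K} : Finset (Fin n)) := by
      intro z hz
      rw [Finset.mem_filter] at hz
      obtain ⟨hzA, u, hu, huz⟩ := hz
      have huX : u ∈ X := by
        rcases (hmemR u).1 hu with rfl | rfl
        · exact hPKX
        · exact hP'KX
      have hzX := hstay u z huX huz
      rcases hrel z hzA hzX with h | h
      · simp [h]
      · simp [h]
    calc _ ≤ ({P K, P' K} : Finset (Fin n)).card := Finset.card_le_card hsub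
      _ ≤ 2 := Finset.card_le_two

/-- **Trichotomy for `c` (any family of two-port classes).**  For `c ∈ A` off the class ports, `j ≤ 2`, and links `L_S = {P I P' I : I ∈ S}`:
(i) `c` sees more than `j` relays in `ω ∪ L_S` for every `S`; or (ii) at most `j` for every `S`, and `c` is separated in `ω` from every port;
or (iii) there is a port `r` joined to `c` in `ω`, every relay joined to `c` is `c` or `r`, `c` sees at most `j` relays in `ω`, and for every
`S`: `c` sees at most `j` relays in `ω ∪ L_S` iff no class of `S` has the port `r`, in which case the cluster of `c` is unchanged. [folklore] -/
theorem classes_c_trichotomy (ω : BondConfig (Fin n)) (A : Finset (Fin n)) (P P' : Fin M → Fin n) (c : Fin n) (j : ℕ) (hj : j ≤ 2)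
    (hPA : ∀ I, P I ∈ A) (hP'A : ∀ I, P' I ∈ A) (hPP' : ∀ I, P I ≠ P' I) (hcA : c ∈ A) (hcP : ∀ I, c ≠ P I ∧ c ≠ P' I) :
    (∀ S : Finset (Fin M), j < (A.filter fun z =>
        (openGraph (ω ∪ ↑(S.image fun I => (s(P I, P' I) : Sym2 (Fin n))))).Reachable c z).card) ∨
    ((∀ S : Finset (Fin M), (A.filter fun z =>
        (openGraph (ω ∪ ↑(S.image fun I => (s(P I, P' I) : Sym2 (Fin n))))).Reachable c z).card ≤ j) ∧
      (∀ I, ¬ (openGraph ω).Reachable c (P I) ∧ ¬ (openGraph ω).Reachable c (P' I)) ∧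
      (A.filter fun z => (openGraph ω).Reachable c z).card ≤ j) ∨
    (∃ r, (openGraph ω).Reachable c r ∧ (∃ I₀, r = P I₀ ∨ r = P' I₀) ∧
        (∀ u ∈ A, (openGraph ω).Reachable c u → u = c ∨ u = r) ∧
        (A.filter fun z => (openGraph ω).Reachable c z).card ≤ j ∧
        (∀ S : Finset (Fin M), (A.filter fun z =>
            (openGraph (ω ∪ ↑(S.image fun I => (s(P I, P' I) : Sym2 (Fin n))))).Reachable c z).card ≤ j ↔
          ∀ I ∈ S, P I ≠ r ∧ P' I ≠ r) ∧
        (∀ S : Finset (Fin M), (∀ I ∈ S, P I ≠ r ∧ P' I ≠ r) →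
          ∀ y, (openGraph (ω ∪ ↑(S.image fun I => (s(P I, P' I) : Sym2 (Fin n))))).Reachable c y ↔ (openGraph ω).Reachable c y)) := by
  set L : Finset (Fin M) → Set (Sym2 (Fin n)) := fun S => ↑(S.image fun I => (s(P I, P' I) : Sym2 (Fin n))) with hL
  change (∀ S : Finset (Fin M), j < (A.filter fun z => (openGraph (ω ∪ L S)).Reachable c z).card) ∨
    ((∀ S : Finset (Fin M), (A.filter fun z => (openGraph (ω ∪ L S)).Reachable c z).card ≤ j) ∧
      (∀ I, ¬ (openGraph ω).Reachable c (P I) ∧ ¬ (openGraph ω).Reachable c (P' I)) ∧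
      (A.filter fun z => (openGraph ω).Reachable c z).card ≤ j) ∨
    (∃ r, (openGraph ω).Reachable c r ∧ (∃ I₀, r = P I₀ ∨ r = P' I₀) ∧
        (∀ u ∈ A, (openGraph ω).Reachable c u → u = c ∨ u = r) ∧
        (A.filter fun z => (openGraph ω).Reachable c z).card ≤ j ∧
        (∀ S : Finset (Fin M), (A.filter fun z => (openGraph (ω ∪ L S)).Reachable c z).card ≤ j ↔ ∀ I ∈ S, P I ≠ r ∧ P' I ≠ r) ∧
        (∀ S : Finset (Fin M), (∀ I ∈ S, P I ≠ r ∧ P' I ≠ r) → ∀ y, (openGraph (ω ∪ L S)).Reachable c y ↔ (openGraph ω).Reachable c y))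
  have hmemL : ∀ S e, e ∈ L S ↔ ∃ I ∈ S, (s(P I, P' I) : Sym2 (Fin n)) = e := by
    intro S e
    simp only [hL, Finset.coe_image, Set.mem_image, Finset.mem_coe]
  -- links avoiding the cluster of `c` do not change it
  have hunch : ∀ S : Finset (Fin M), (∀ I ∈ S, ¬ (openGraph ω).Reachable c (P I) ∧ ¬ (openGraph ω).Reachable c (P' I)) →
      ∀ y, (openGraph (ω ∪ L S)).Reachable c y ↔ (openGraph ω).Reachable c y := by
    intro S hS
    refine reachable_union_links_iff ω (L S) c fun e he v hv => ?_
    obtain ⟨I, hI, rfl⟩ := (hmemL S e).1 he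
    rcases Sym2.mem_iff.1 hv with rfl | rfl
    · exact (hS I hI).1
    · exact (hS I hI).2
  by_cases hheavy : j < (A.filter fun z => (openGraph ω).Reachable c z).card
  · -- (i)
    refine Or.inl fun S => lt_of_lt_of_le hheavy (Finset.card_le_card fun z hz => ?_)
    rw [Finset.mem_filter] at hz ⊢
    exact ⟨hz.1, reachable_mono_union ω (L S) hz.2⟩
  push Not at hheavy
  by_cases hport : ∃ I, (openGraph ω).Reachable c (P I) ∨ (openGraph ω).Reachable c (P' I)
  · -- (iii)
    obtain ⟨I₀, hI₀⟩ := hport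
    obtain ⟨r, hr, hrI₀, hrA⟩ : ∃ r, (openGraph ω).Reachable c r ∧ (r = P I₀ ∨ r = P' I₀) ∧ r ∈ A := by
      rcases hI₀ with h | h
      · exact ⟨P I₀, h, Or.inl rfl, hPA I₀⟩
      · exact ⟨P' I₀, h, Or.inr rfl, hP'A I₀⟩
    have hrc : r ≠ c := by
      rcases hrI₀ with rfl | rfl
      · exact (hcP I₀).1.symm
      · exact (hcP I₀).2.symm
    -- every relay joined to `c` is `c` or `r`
    have honly : ∀ u ∈ A, (openGraph ω).Reachable c u → u = c ∨ u = r := by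
      intro u huA hu
      by_contra hne
      push Not at hne
      have hsub : ({c, r, u} : Finset (Fin n)) ⊆ A.filter fun z => (openGraph ω).Reachable c z := by
        intro z hz
        simp only [Finset.mem_insert, Finset.mem_singleton] at hz
        rw [Finset.mem_filter]
        rcases hz with rfl | rfl | rfl
        · exact ⟨hcA, SimpleGraph.Reachable.refl _⟩
        · exact ⟨hrA, hr⟩
        · exact ⟨huA, hu⟩
      have hcard : ({c, r, u} : Finset (Fin n)).card = 3 := by
        rw [Finset.card_insert_of_notMem, Finset.card_pair (Ne.symm hne.2)]
        simp only [Finset.mem_insert, Finset.mem_singleton, not_or]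
        exact ⟨hrc.symm, (Ne.symm hne.1)⟩
      have := Finset.card_le_card hsub
      omega
    have hportfar : ∀ I, (P I ≠ r → ¬ (openGraph ω).Reachable c (P I)) ∧ (P' I ≠ r → ¬ (openGraph ω).Reachable c (P' I)) := by
      intro I
      refine ⟨fun hne h => ?_, fun hne h => ?_⟩
      · rcases honly (P I) (hPA I) h with h' | h'
        · exact (hcP I).1 h'.symm
        · exact hne h'
      · rcases honly (P' I) (hP'A I) h with h' | h'
        · exact (hcP I).2 h'.symm
        · exact hne h'
    have hGiff : ∀ S, (A.filter fun z => (openGraph (ω ∪ L S)).Reachable c z).card ≤ j ↔ ∀ I ∈ S, P I ≠ r ∧ P' I ≠ r := by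
      intro S
      constructor
      · intro hsmall I hI
        have he : (s(P I, P' I) : Sym2 (Fin n)) ∈ L S := (hmemL S _).2 ⟨I, hI, rfl⟩
        constructor
        · intro hPr
          have h3 := three_le_card_of_reachable_link ω (L S) A c hcA (hPP' I) (hPA I) (hP'A I) (hcP I).1.symm (hcP I).2.symm he
            (by rw [hPr]; exact reachable_mono_union ω (L S) hr)
          have := h3.trans ((card_filter_congr fun _ _ => Iff.rfl).trans_le hsmall)
          omega
        · intro hP'r
          have he' : (s(P' I, P I) : Sym2 (Fin n)) ∈ L S := by rw [Sym2.eq_swap]; exact he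
          have h3 := three_le_card_of_reachable_link ω (L S) A c hcA (hPP' I).symm (hP'A I) (hPA I) (hcP I).2.symm (hcP I).1.symm
            he' (by rw [hP'r]; exact reachable_mono_union ω (L S) hr)
          have := h3.trans ((card_filter_congr fun _ _ => Iff.rfl).trans_le hsmall)
          omega
      · intro hS
        have hiff := hunch S (fun I hI => ⟨(hportfar I).1 (hS I hI).1, (hportfar I).2 (hS I hI).2⟩)
        have hset : (A.filter fun z => (openGraph (ω ∪ L S)).Reachable c z) = A.filter fun z => (openGraph ω).Reachable c z :=
          Finset.filter_congr fun z _ => hiff z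
        rw [hset]; exact hheavy
    refine Or.inr (Or.inr ⟨r, hr, ⟨I₀, hrI₀⟩, honly, hheavy, hGiff, fun S hS => ?_⟩)
    exact hunch S (fun I hI => ⟨(hportfar I).1 (hS I hI).1, (hportfar I).2 (hS I hI).2⟩)
  · -- (ii)
    push Not at hport
    refine Or.inr (Or.inl ⟨fun S => ?_, hport, hheavy⟩)
    have hiff := hunch S (fun I _ => hport I)
    have hset : (A.filter fun z => (openGraph (ω ∪ L S)).Reachable c z) = A.filter fun z => (openGraph ω).Reachable c z :=
      Finset.filter_congr fun z _ => hiff z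
    rw [hset]; exact hheavy

end StarSet

end Summit.CriticalPhenomena.PercolationContinuityZ3.Theorems

end
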